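import Summits.CriticalPhenomena.PercolationContinuityZ3.Theorems.PercNearOneGluingNoHeavyLowerTailAPLLightTargetsMarkov
import HarnessLib

/-!
# `NoHeavyLowerTail` (stmt-CriticalPhenomena-4575) — non-uniform APL, part I: paths off a (glued) apex SET and the cell identities

Support file (prover seat `prim-cert-1`, gen 16; `--supports stmt-CriticalPhenomena-4575`).  No definitions, no named facts, no sorries.
Part I of the decoupling inequality `…APLNonuniformDecoupling` (parts II `…APLNonuniformFibres`, III `…APLNonuniformDecoupling`),
used by the no-contraction induction of `…APLNonuniform` (algebra in `…APLNonuniformStep`).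

SETTING.  Configurations `ω : BondConfig V`; a vertex SET `S` (the apex, GLUED: `S ↔ x := ∃ s ∈ S, s ↔ x`) and targets
`b, c ∉ S`; `T_b(ω) = openCluster (ω ∩ {e | ∀ x ∈ e, x ∉ S}) b` the cluster of `b` among the pairs inside `Sᶜ`, and
`EX_b := ∃ s ∈ S, ∃ t ∈ T_b(ω), s(s,t) ∈ ω` ("the apex set has an open pair into `T_b`").
* paths (`offSet_not_mem`, `exit_or_mem_of_reachable`, `setConn_iff_exit`: **`S ↔ b ⟺ EX_b`** by the last exit from `S`;
  `exits_of_openConn_of_not_mem`: `b ↔ c ∧ c ∉ T_b ⟹ EX_b ∧ EX_c`; `offSet_cluster_eq_of_not_mem`: on `{c ∉ T_b}` the cluster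
  `T_c` is the cluster of `c` among the pairs inside `Sᶜ ∖ T_b`);
* cells, with `D° = {c ∉ T_b}`: `{S↔b, S↮c} = D° ∩ EX_b ∩ EX_cᶜ` (`cell_ab_eq`), `{S↮b, S↮c, b↮c} = D° ∩ (EX_b ∪ EX_c)ᶜ`
  (`cell_0_eq`), `D° ∩ ({b↔c} ∪ ({S↔b} ∩ {S↔c})) = D° ∩ EX_b ∩ EX_c` (`cell_y_eq`).
[folklore; this work]
-/

noncomputable section

namespace Summit.CriticalPhenomena.PercolationContinuityZ3.Theorems

namespace APL

open MeasureTheory Literature.Probability.Percolation Literature.Probability.LatticeModels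
open scoped Classical

/-! ### Paths off an apex set -/

section Paths

variable {V : Type*}

/-- The cluster of `b ∉ S` among the pairs inside `Sᶜ` avoids `S`. [folklore] -/
theorem offSet_not_mem {S : Set V} {b y : V} {ω : BondConfig V} (hb : b ∉ S)
    (hy : y ∈ openCluster (ω ∩ {e | ∀ x ∈ e, x ∉ S}) b) : y ∉ S := by
  have hr : (openGraph (ω ∩ {e | ∀ x ∈ e, x ∉ S})).Reachable b y := hy
  rw [SimpleGraph.reachable_iff_reflTransGen] at hr
  induction hr with
  | refl => exact hb
  | @tail x z _ hxz _ =>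
    have h' := (openGraph_adj _ x z).1 hxz
    exact h'.1.2 z (Sym2.mem_mk_right x z)

/-- The cluster off `S` is closed under open steps between vertices outside `S`. [folklore] -/
theorem mem_offSet_of_adj {S : Set V} {b x z : V} {ω : BondConfig V}
    (hx : x ∈ openCluster (ω ∩ {e | ∀ x ∈ e, x ∉ S}) b) (hxz : s(x, z) ∈ ω) (hne : x ≠ z)
    (hxS : x ∉ S) (hzS : z ∉ S) : z ∈ openCluster (ω ∩ {e | ∀ x ∈ e, x ∉ S}) b := by
  have hr : (openGraph (ω ∩ {e | ∀ x ∈ e, x ∉ S})).Reachable b x := hx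
  have hadj : (openGraph (ω ∩ {e | ∀ x ∈ e, x ∉ S})).Adj x z := by
    rw [openGraph_adj]
    refine ⟨⟨hxz, fun v hv => ?_⟩, hne⟩
    rcases Sym2.mem_iff.1 hv with h | h
    · exact h ▸ hxS
    · exact h ▸ hzS
  exact hr.trans hadj.reachable

/-- **Last exit from the apex set.**  If `x ↔ b` with `b ∉ S`, then either `x ∈ T_b` or some open pair joins a vertex of `S`
to the cluster `T_b` of `b` off `S`. [folklore] -/
theorem exit_or_mem_of_reachable {S : Set V} {b x : V} {ω : BondConfig V} (hb : b ∉ S)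
    (h : (openGraph ω).Reachable b x) :
    x ∈ openCluster (ω ∩ {e | ∀ x ∈ e, x ∉ S}) b ∨
      ∃ s ∈ S, ∃ t ∈ openCluster (ω ∩ {e | ∀ x ∈ e, x ∉ S}) b, s(s, t) ∈ ω := by
  rw [SimpleGraph.reachable_iff_reflTransGen] at h
  induction h with
  | refl => exact Or.inl (mem_openCluster_self _ b)
  | @tail y z _ hyz ih =>
    rcases ih with hy | hdone
    · have h' := (openGraph_adj ω y z).1 hyz
      have hyS : y ∉ S := offSet_not_mem hb hy
      by_cases hzS : z ∈ S
      · exact Or.inr ⟨z, hzS, y, hy, Sym2.eq_swap ▸ h'.1⟩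
      · exact Or.inl (mem_offSet_of_adj hy h'.1 h'.2 hyS hzS)
    · exact Or.inr hdone

/-- **The glued apex reaches `b` iff it has an open pair into `T_b`** (`b ∉ S`). [folklore] -/
theorem setConn_iff_exit {S : Set V} {b : V} {ω : BondConfig V} (hb : b ∉ S) :
    (∃ s ∈ S, ω ∈ openConn s b) ↔ ∃ s ∈ S, ∃ t ∈ openCluster (ω ∩ {e | ∀ x ∈ e, x ∉ S}) b, s(s, t) ∈ ω := by
  constructor
  · rintro ⟨s, hs, hsb⟩
    have hbs : (openGraph ω).Reachable b s := SimpleGraph.Reachable.symm hsb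
    rcases exit_or_mem_of_reachable hb hbs with h | h
    · exact absurd hs (offSet_not_mem hb h)
    · exact h
  · rintro ⟨s, hs, t, ht, hst⟩
    refine ⟨s, hs, ?_⟩
    have htb : (openGraph ω).Reachable b t :=
      (openCluster_mono Set.inter_subset_left b ht : t ∈ openCluster ω b)
    have hts : (openGraph ω).Adj t s := by
      rw [openGraph_adj]
      exact ⟨Sym2.eq_swap ▸ hst, fun h => (offSet_not_mem hb ht) (h ▸ hs)⟩
    exact (htb.trans hts.reachable).symm

/-- Symmetry of the clusters off `S`: `c ∈ T_b ↔ b ∈ T_c`. [folklore] -/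
theorem mem_offSet_comm {S : Set V} {b c : V} {ω : BondConfig V} :
    c ∈ openCluster (ω ∩ {e | ∀ x ∈ e, x ∉ S}) b ↔ b ∈ openCluster (ω ∩ {e | ∀ x ∈ e, x ∉ S}) c :=
  ⟨fun h => SimpleGraph.Reachable.symm h, fun h => SimpleGraph.Reachable.symm h⟩

/-- If `t ∈ T_b` and `c ∈ T_b` then `t ∈ T_c`. [folklore] -/
theorem mem_offSet_of_mem_of_mem {S : Set V} {b c t : V} {ω : BondConfig V}
    (ht : t ∈ openCluster (ω ∩ {e | ∀ x ∈ e, x ∉ S}) b) (hc : c ∈ openCluster (ω ∩ {e | ∀ x ∈ e, x ∉ S}) b) :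
    t ∈ openCluster (ω ∩ {e | ∀ x ∈ e, x ∉ S}) c :=
  (SimpleGraph.Reachable.symm hc).trans ht

/-- **Joining through the glued apex.**  If `b ↔ c` but `c ∉ T_b` (no `b`–`c` path avoids `S`), then the apex set has open pairs
into both `T_b` and `T_c`. [folklore] -/
theorem exits_of_openConn_of_not_mem {S : Set V} {b c : V} {ω : BondConfig V} (hb : b ∉ S) (hc : c ∉ S)
    (hbc : ω ∈ openConn b c) (hcT : c ∉ openCluster (ω ∩ {e | ∀ x ∈ e, x ∉ S}) b) :
    (∃ s ∈ S, ∃ t ∈ openCluster (ω ∩ {e | ∀ x ∈ e, x ∉ S}) b, s(s, t) ∈ ω) ∧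
      ∃ s ∈ S, ∃ t ∈ openCluster (ω ∩ {e | ∀ x ∈ e, x ∉ S}) c, s(s, t) ∈ ω := by
  have h1 : (openGraph ω).Reachable b c := hbc
  constructor
  · rcases exit_or_mem_of_reachable hb h1 with h | h
    · exact absurd h hcT
    · exact h
  · rcases exit_or_mem_of_reachable hc h1.symm with h | h
    · exact absurd (mem_offSet_comm.1 h) hcT
    · exact h

/-- On `{c ∉ T_b}` the cluster of `c` off `S` is its cluster among the pairs inside `Sᶜ ∖ T_b`. [folklore] -/
theorem offSet_cluster_eq_of_not_mem {S : Set V} {b c : V} {ω : BondConfig V}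
    (hcT : c ∉ openCluster (ω ∩ {e | ∀ x ∈ e, x ∉ S}) b) :
    openCluster (ω ∩ {e | ∀ x ∈ e, x ∉ S}) c =
      openCluster (ω ∩ {e | ∀ x ∈ e, x ∉ S} ∩ {e | ∀ x ∈ e, x ∉ openCluster (ω ∩ {e | ∀ x ∈ e, x ∉ S}) b}) c := by
  apply Set.Subset.antisymm
  · intro y hy
    have hr : (openGraph (ω ∩ {e | ∀ x ∈ e, x ∉ S})).Reachable c y := hy
    rw [SimpleGraph.reachable_iff_reflTransGen] at hr
    -- invariant: `z ∉ T_b` and `z` reachable from `c` in the smaller graph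
    have key : ∀ z, Relation.ReflTransGen (openGraph (ω ∩ {e | ∀ x ∈ e, x ∉ S})).Adj c z →
        z ∉ openCluster (ω ∩ {e | ∀ x ∈ e, x ∉ S}) b ∧
          (openGraph (ω ∩ {e | ∀ x ∈ e, x ∉ S} ∩
            {e | ∀ x ∈ e, x ∉ openCluster (ω ∩ {e | ∀ x ∈ e, x ∉ S}) b})).Reachable c z := by
      intro z hz
      induction hz with
      | refl => exact ⟨hcT, SimpleGraph.Reachable.refl _⟩
      | @tail x z hcx hxz ih =>
        obtain ⟨hxT, hrx⟩ := ih
        have h' := (openGraph_adj _ x z).1 hxz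
        have hzT : z ∉ openCluster (ω ∩ {e | ∀ x ∈ e, x ∉ S}) b := by
          intro hz
          apply hxT
          -- `z ∈ T_b` and `x ~ z` in the graph off `S` gives `x ∈ T_b`
          have hzx : (openGraph (ω ∩ {e | ∀ x ∈ e, x ∉ S})).Adj z x := hxz.symm
          exact (show (openGraph (ω ∩ {e | ∀ x ∈ e, x ∉ S})).Reachable b z from hz).trans hzx.reachable
        refine ⟨hzT, hrx.trans (SimpleGraph.Adj.reachable ?_)⟩
        rw [openGraph_adj]
        refine ⟨⟨h'.1, fun v hv => ?_⟩, h'.2⟩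
        rcases Sym2.mem_iff.1 hv with h | h
        · exact h ▸ hxT
        · exact h ▸ hzT
    exact (key y hr).2
  · exact openCluster_mono (Set.inter_subset_left) c

end Paths

/-! ### The cell identities (pure set algebra on the configuration space) -/

section Cells

variable {V : Type*} (S : Set V) (b c : V)

/-- `uab`-event: `{S ↔ b, S ↮ c} = {c ∉ T_b} ∩ EX_b ∩ EX_cᶜ`. [folklore] -/
theorem cell_ab_eq (hb : b ∉ S) (hc : c ∉ S) :
    ({ω : BondConfig V | ∃ s ∈ S, ω ∈ openConn s b} ∩ {ω | ∃ s ∈ S, ω ∈ openConn s c}ᶜ) =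
      {ω | c ∉ openCluster (ω ∩ {e | ∀ x ∈ e, x ∉ S}) b} ∩
        ({ω | ∃ s ∈ S, ∃ t ∈ openCluster (ω ∩ {e | ∀ x ∈ e, x ∉ S}) b, s(s, t) ∈ ω} ∩
          {ω | ∃ s ∈ S, ∃ t ∈ openCluster (ω ∩ {e | ∀ x ∈ e, x ∉ S}) c, s(s, t) ∈ ω}ᶜ) := by
  ext ω
  simp only [Set.mem_inter_iff, Set.mem_compl_iff, Set.mem_setOf_eq]
  rw [setConn_iff_exit hb, setConn_iff_exit hc]
  constructor
  · rintro ⟨hB, hC⟩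
    refine ⟨fun hcT => hC ?_, hB, hC⟩
    obtain ⟨s, hs, t, ht, hst⟩ := hB
    exact ⟨s, hs, t, mem_offSet_of_mem_of_mem ht hcT, hst⟩
  · rintro ⟨-, hB, hC⟩
    exact ⟨hB, hC⟩

/-- `u0`-event: `{S ↮ b, S ↮ c, b ↮ c} = {c ∉ T_b} ∩ (EX_b ∪ EX_c)ᶜ`. [folklore] -/
theorem cell_0_eq (hb : b ∉ S) (hc : c ∉ S) :
    ({ω : BondConfig V | ∃ s ∈ S, ω ∈ openConn s b}ᶜ ∩ {ω | ∃ s ∈ S, ω ∈ openConn s c}ᶜ ∩ (openConn b c)ᶜ) =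
      {ω | c ∉ openCluster (ω ∩ {e | ∀ x ∈ e, x ∉ S}) b} ∩
        ({ω | ∃ s ∈ S, ∃ t ∈ openCluster (ω ∩ {e | ∀ x ∈ e, x ∉ S}) b, s(s, t) ∈ ω} ∪
          {ω | ∃ s ∈ S, ∃ t ∈ openCluster (ω ∩ {e | ∀ x ∈ e, x ∉ S}) c, s(s, t) ∈ ω})ᶜ := by
  ext ω
  simp only [Set.mem_inter_iff, Set.mem_compl_iff, Set.mem_union, Set.mem_setOf_eq, not_or]
  rw [setConn_iff_exit hb, setConn_iff_exit hc]
  constructor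
  · rintro ⟨⟨hB, hC⟩, hbc⟩
    refine ⟨fun hcT => hbc ?_, hB, hC⟩
    exact (openCluster_mono Set.inter_subset_left b hcT : c ∈ openCluster ω b)
  · rintro ⟨hcT, hB, hC⟩
    refine ⟨⟨hB, hC⟩, fun hbc => ?_⟩
    exact hB (exits_of_openConn_of_not_mem hb hc hbc hcT).1

/-- `y`-event: `{c ∉ T_b} ∩ ({b ↔ c} ∪ ({S↔b} ∩ {S↔c})) = {c ∉ T_b} ∩ EX_b ∩ EX_c`. [folklore] -/
theorem cell_y_eq (hb : b ∉ S) (hc : c ∉ S) :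
    ({ω : BondConfig V | c ∉ openCluster (ω ∩ {e | ∀ x ∈ e, x ∉ S}) b} ∩
        (openConn b c ∪ ({ω | ∃ s ∈ S, ω ∈ openConn s b} ∩ {ω | ∃ s ∈ S, ω ∈ openConn s c}))) =
      {ω | c ∉ openCluster (ω ∩ {e | ∀ x ∈ e, x ∉ S}) b} ∩
        ({ω | ∃ s ∈ S, ∃ t ∈ openCluster (ω ∩ {e | ∀ x ∈ e, x ∉ S}) b, s(s, t) ∈ ω} ∩
          {ω | ∃ s ∈ S, ∃ t ∈ openCluster (ω ∩ {e | ∀ x ∈ e, x ∉ S}) c, s(s, t) ∈ ω}) := by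
  ext ω
  simp only [Set.mem_inter_iff, Set.mem_union, Set.mem_setOf_eq]
  rw [setConn_iff_exit hb, setConn_iff_exit hc]
  constructor
  · rintro ⟨hcT, h⟩
    refine ⟨hcT, ?_⟩
    rcases h with hbc | hBC
    · exact exits_of_openConn_of_not_mem hb hc hbc hcT
    · exact hBC
  · rintro ⟨hcT, hBC⟩
    exact ⟨hcT, Or.inr hBC⟩

end Cells

end APL

end Summit.CriticalPhenomena.PercolationContinuityZ3.Theorems

end
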